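import Summits.HubbardSuperconductivity.HubbardSuperconductivity.Theses.ComplexGFFStiffness
import Summits.HubbardSuperconductivity.HubbardSuperconductivity.Theorems.ComplexGFFStiffnessDefs
import Summits.HubbardSuperconductivity.HubbardSuperconductivity.Theorems.ComplexGFFStiffnessHypACumulantZOfGNV
import Literature.MathematicalPhysics.StatisticalMechanics.TorusFRDHolds

/-!
# Line `gnv` — crux `HypALocalTwoPoint` of route `route-HubbardSuperconductivity-ComplexGFFStiffness`

Crux item stmt-HubbardSuperconductivity-19155 (rank 3; decl
`Summit.HubbardSuperconductivity.HubbardSuperconductivity.Theses.ComplexGFFStiffness.HypALocalTwoPoint`).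
Lead: prover-hubbard-h2gff-p1-g0-0 (2026-08-26).  Sibling of `Cruxes/HypACumulant/Lines/gnv.lean`
(same line, same first stub): supersedes the birth skeleton `Lines/birth.lean` (stubs
`stub_zNonvanishing`, `stub_twoPointGivenZ`) by transferring the shared first rung UP —
`ZNonvanishing` is PROVED from `GNV` (v2: cut into `stub_frd : TorusFRD 4`, in print, and the research stub `stub_gnvOfFrd : TorusFRD 4 → GNV`) (generalised non-vanishing for
`ι`-admissible complex single-site gradient perturbations; ABKM19 = arXiv:1910.13564 Thm 2.2,
representation half, on the `ι`-symmetric complex class) by the landed reduction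
`…Theorems.ComplexGFF.zNonvanishing_of_gnv`; the second stub `stub_twoPointGivenZ : TwoPointGivenZ`
(the `ℓ = 1`, `K`-uniform smoothness half) is unchanged.  See `Cruxes/HypACumulant/Lines/gnv.md`
for the line card (idea, stubs, sizes, why not the isotropic dielectric trick, foreseen reshape
`stub_gnv ⇐ stub_frd + stub_gnvOfFrd`).

Registrar shape: `hypALocalTwoPoint_of_stubs : GNV → TwoPointGivenZ → <body of HypALocalTwoPoint>`
is a real proof; `HypALocalTwoPoint_of : HypALocalTwoPoint` concludes the crux BY NAME; `sorry`
occurs only in the `stub_*` theorems (namespace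
`Summit.HubbardSuperconductivity.HubbardSuperconductivity.Theorems.ComplexGFF`, the namespace a
landing Theorems file must use).

v3 (2026-08-27, literature seat `hubbard-h2gff-lit-1`): `stub_frd` is PROVED and is no longer a stub —
the named fact is discharged in Literature for every dimension,
`Literature.MathematicalPhysics.StatisticalMechanics.GradientFRD.TorusFRD_holds : ∀ d, TorusFRD d`
(`Literature/MathematicalPhysics/StatisticalMechanics/TorusFRDHolds.lean`, p485072; Buchholz 2018 Thm 2.4,
scalar case, 16 sorry-free modules), and `stub_frd := TorusFRD_holds 4` below.  Registered stubs after v3: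
`stub_gnvOfFrd`, `stub_twoPointGivenZ` (the only `sorry`s of the file).
-/

noncomputable section

-- `Summit.<Summit>.<Problem>`: single-conjunct summit, the duplicate component is mandated (D-0017).
set_option linter.dupNamespace false

namespace Summit.HubbardSuperconductivity.HubbardSuperconductivity.Theorems.ComplexGFF

open Literature.MathematicalPhysics.StatisticalMechanics.ComplexGradientGFF4 (Z ev Y D LocalTwoPointAt)
open Summit.HubbardSuperconductivity.HubbardSuperconductivity.Theses.ComplexGFFStiffness (HypALocalTwoPoint)

/-! ## Stub 1a `stub_frd` — PROVED (v3; no longer a registered stub) -/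

/-- **Stub 1a — `stub_frd` (PROVED, v3).** The finite-range decomposition of the torus Green's
functions of `∇*A∇`, `A ∈ 𝓛(ω₀, Ω₀)`, on `(ℤ/L^N)^4` with regularity in `A` and two-sided Fourier shell
bounds: Buchholz 2018 Thm 2.4 = ABKM19 Thm 6.1, the Literature named fact `GradientFRD.TorusFRD` at
`d = 4`, now a THEOREM by its Literature discharge `GradientFRD.TorusFRD_holds` (TorusFRDHolds.lean,
p485072). [cite: Buchholz2016, Thm 2.4] -/
theorem stub_frd : Literature.MathematicalPhysics.StatisticalMechanics.GradientFRD.TorusFRD 4 :=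
  Literature.MathematicalPhysics.StatisticalMechanics.GradientFRD.TorusFRD_holds 4

/-! ## The registered stubs (the ONLY `sorry`s of the file) -/

/-- **Stub 1b — `stub_gnvOfFrd` (OPEN; the research stub, shared with `HypACumulant`; size XL).**
ABKM19 Thm 2.2 (representation half) ⊗ ℂ on the `ι`-symmetric class, GIVEN the finite-range
decomposition: `TorusFRD 4 → GNV`.  Why it might fail: a non-`ι`-equivariant step in the printed
renormalisation group (complex tuned form), or a clause missing from the typed fact. -/
theorem stub_gnvOfFrd :
    Literature.MathematicalPhysics.StatisticalMechanics.GradientFRD.TorusFRD 4 → GNV := by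
  sorry

/-- `GNV` from its cut: the PROVED `stub_frd` and the research stub `stub_gnvOfFrd` (bookkeeping). -/
theorem gnv_of_stubs : GNV := stub_gnvOfFrd stub_frd

/-- **Stub 2 — `stub_twoPointGivenZ` (OPEN; the smoothness half with a bounded-range observable;
size L; unchanged from the birth skeleton).** [ABKM19] Secs. 10–12 with the observable extension
(Hilger, arXiv:2007.10869): first-order dependence on `t ↦ t𝒦_g` of the expectation of
`cos(z_i/√K)`, uniformly in `N` and `K ≥ 1`, given that the flow exists. Why it might fail:
`cos(z_i/√K)·(1+𝒦_g)` must lie in the paper's Banach space `E` with norm `O(1)` uniformly in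
`K ≥ 1`. -/
theorem stub_twoPointGivenZ : TwoPointGivenZ := by
  sorry

/-! ## Composition (sorry-free) and the registered target -/

/-- **Composition (kernel-checked, no `sorry` in its closure).** `GNV` and `TwoPointGivenZ` imply
the crux statement — verbatim the body of
`Summit.HubbardSuperconductivity.HubbardSuperconductivity.Theses.ComplexGFFStiffness.HypALocalTwoPoint`:
`GNV → ZNonvanishing` is the landed reduction `zNonvanishing_of_gnv`; then merge the thresholds
(`L₀ := max`, `g₀ := min`) and feed the non-vanishing into the conditional two-point bound. -/
theorem hypALocalTwoPoint_of_stubs (h₁ : GNV) (h₂ : TwoPointGivenZ) :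
    ∃ L₀ : ℕ, ∀ L : ℕ, Odd L → L₀ ≤ L → ∃ g₀ C : ℝ, 0 < g₀ ∧ LocalTwoPointAt L g₀ C := by
  obtain ⟨L₁, h₁⟩ := zNonvanishing_of_gnv h₁
  obtain ⟨L₂, h₂⟩ := h₂
  refine ⟨max L₁ L₂, fun L hL hle => ?_⟩
  obtain ⟨g₁, hg₁, hZ⟩ := h₁ L hL (le_trans (le_max_left _ _) hle)
  obtain ⟨g₂, C, hg₂, hC⟩ := h₂ L hL (le_trans (le_max_right _ _) hle)
  refine ⟨min g₁ g₂, C, lt_min hg₁ hg₂, ?_⟩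
  intro g hg0 hg N hN n _ hn
  have hz : Z n g 0 ≠ 0 := hZ g hg0 (le_trans hg (min_le_left _ _)) N hN n hn
  exact ⟨hz, hC g hg0 (le_trans hg (min_le_right _ _)) N hN n hn hz⟩

/-- **Registered target of the skeleton.** The crux BY NAME, no hypotheses. -/
theorem HypALocalTwoPoint_of : HypALocalTwoPoint :=
  hypALocalTwoPoint_of_stubs gnv_of_stubs stub_twoPointGivenZ

end Summit.HubbardSuperconductivity.HubbardSuperconductivity.Theorems.ComplexGFF

end
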